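import Summits.BirchSwinnertonDyer.BirchSwinnertonDyer.Theorems.PrintCf2SplitBadTwoLayerDualShapiroLocal
import Summits.BirchSwinnertonDyer.BirchSwinnertonDyer.Theorems.PrintCf2SplitBadTwoLayerLocSurjOfDualPullback
import Summits.BirchSwinnertonDyer.BirchSwinnertonDyer.Theorems.SchneiderFreeAdditiveX3PoitouTateUnramifiedOrthogonalAllLevels
import Literature.NumberTheory.GaloisRepresentations.ContinuousShapiroLiftFunctor
import HarnessLib

/-!
# Crux `PrintCf2.SplitBadTwoRankOneOfFacts` (stmt-BirchSwinnertonDyer-20368), skeleton v13.2, stub S3n′ `stub_pseudoNullFinite_two`,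
# S3N-FACTFREE brick R2, file 6b (B2d of `Cruxes/…/R2-BRICKS-w5g7.md` §5, THE READING): B2c's displayed hypothesis `hkill`
# («`H¹(ιc^D)` kills the canonical dual Selmer group `H¹_{𝓕*}(K, Maps(Γ_K ⧸ U, M)^D)`», p702949) FROM A (PRO-NULL) STATEMENT IN THE
# LINE'S CURRENCY — every dual class is the dual Shapiro lift `H¹(Ψ)(Sh y′)` of a layer class `y′ ∈ H¹(U, M′)` of the dual module which
# is LOCALLY TRIVIAL above the `𝓕 = ⊤` places and UNRAMIFIED above the good places, and `H¹(ιc^D)` is the level push `jD_*` on `y′`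

Cell `bsd-print-cf2`, WIDTH seat `bsd-line-cf2-p1-w8` g5 (prover-bsd-line-cf2-p1-w8-g5-0); `--supports stmt-BirchSwinnertonDyer-20368`
(helper, Theses-free). HONEST FRAMING: nothing here closes the crux or a registered stub; BSD is not proved by any of this; no summit
statement is proved by this seat. No definition, no named fact, no `sorry`. Unconditional.

SETTING (that of B2a/B2c). `K` a number field; `M` a discrete `Γ_K`-module with open stabilisers (`hM`; `ofSMul M hM`, X11b `LocBridge`);
`U ⊴ Γ_K` open of finite index with representatives `s` (`hs`, `hs1`); `Maps(Γ_K ⧸ U, M) = (ofSMul M hM).coind U hU` (`toTopRep = coindFin` by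
`rfl`); `Sh` the Shapiro lift; `w` a finite place, `θ_w = absGaloisRestrict K K_w`, `D_w = decomp w = range θ_w`. DUAL DATA: a discrete
`Γ_K`-module `M′` (`hM'`) with an equivariant PERFECT pairing `B : M × M′ → μₙ` (`hB`, `hBbij`; e.g. `M = ℤ/p^m` trivial or sign-twisted,
`M′ = μ_{p^m}` with the matching twist), whence the tree's summed-pairing duality morphism
`Ψ = coindTateDualMor (ofSMul M hM) (ofSMul M′ hM′) U B : Maps(Γ_K ⧸ U, M′) ⟶ Maps(Γ_K ⧸ U, M)^D` (bijective, `coindTateDualHom_bijective`) and THE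
DUAL SHAPIRO LIFT `y′ ↦ H¹(Ψ)(Sh y′) : H¹(U, M′) ⥲ H¹(K, Maps(Γ_K ⧸ U, M)^D)` (`exists_unique_shapiroLift_coindTateDualMor_eq`, Literature).

WHAT.
* §3 `eq_zero_of_mem_dualLocalCondition_top` (`(⊤)^* = 0`: `LocalInvariants.canonical_isPerfect`),
  `mem_unramifiedSubgroup_of_mem_dualLocalCondition_unramified` (`(H¹_ur)^* = H¹_ur` at `w ∤ n` where the module is unramified — Milne I
  Thm. 2.6 via the tree's `unramifiedOrthogonal_of_isPerfect_allLevels`).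
* §4 `resH1Hom_id_eq_cohomologyMap_subgroupRepMap` (the line's `resH1Hom (id, jD)` IS `H¹(jD|_U)` of the Shapiro files);
  **`map_tateDualComap_dualShapiro`** — NATURALITY IN THE LEVEL: `H¹(ιc^D)(H¹(Ψ)(Sh y′)) = H¹(Ψ₀)(Sh (jD_* y′))` for `ιc = Maps(Γ_K ⧸ U, j)`
  (`j : M₀ → M`), `ιc^D = tateDualComap ιc`, and the TRANSPOSE `jD : M′ → M₀′` (`B₀(m₀, jD m′) = B(j m₀, m′)`); for the levels
  `A[p^k] ↪ A[p^m]` and `μ`-valued pairings `jD` is `ζ ↦ ζ^{p^{m−k}}` (reduction of Kummer classes).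
* §5 **`dualPullback_eq_zero_of_layerProNull`** — `hkill` ⟸ «every `y′ ∈ H¹(U, M′)` which is (i) locally trivial above each `w` with
  `𝓕_w = ⊤` (`∀ σ, conjH1 U M′ σ y′ ∈ awayKer U M′ w`), (ii) unramified above each finite `w ∤ n` with `𝓕_w = H¹_ur` and `Maps(Γ_K ⧸ U, M)`
  unramified (`∀ σ, conjH1 U M′ σ y′ ∈ unramifiedKer U M′ w`), and (iii) whose dual-Shapiro class satisfies `𝓕*_v` at every `v` (displayed
  verbatim — needed only where (i)/(ii) do not read it: `v̄ ∣ n` = brick B5 «`n ∣ ord`», ramified places, infinite places), has `jD_* y′ = 0`»;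
  **`exists_layerClass_of_layerProNull`** — B2c's (SUR_U) at a finite level (both clauses of (LS↑) with `U` for `ker κ₂`) with `hkill`
  REPLACED by that statement.
USE (R2, memo §5): for `M = A_θ[2^m]`, `M′ = μ_{2^m}(θ)`, `jD = (·)^{2^{m−k}}` the remaining hypothesis is (PRO-NULL)_U of the `v`-adic Kummer
tower — -w3 g13 `KummerU.exists_level_forall_exists_pow_eq_of_galois′` (`θ = 1`) / `twisted_proNull_of_untwisted` (`θ` of order 2) ⟸ R1
(p696581, Leopoldt-at-`v` = Baker–Brumer, a theorem of the tree) — once the Kummer/Hilbert-90 identification of `H¹(U, μ_{2^m})`-classes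
with roots (B4a) and the `v̄`-reading (B5) are supplied. NOT here: B4a, B5, the archimedean places (vacuous for `K` imaginary quadratic).
presearch: GV2000 §2 Prop. 2.1, Milne ADT I Thm. 2.6 / 4.10, NSW (1.6.4); no new fact. beyond-print theorem: no.

References: [GreenbergVatsal2000] §2 Prop. 2.1; [MilneADT2006] I §2, Cor. 2.3, Thm. 2.6, Thm. 4.10 (b); [Howard2004HeegnerKolyvagin] Def. 2.1.6,
Thm. 2.1.11; [NeukirchSchmidtWingberg2008] I §5 Prop. (1.5.3)(iv), I §6 (1.6.4)–(1.6.5); [SerreGaloisCohomology1997] I §2.4.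
-/

noncomputable section

open scoped Classical ContRepresentation

set_option linter.dupNamespace false
set_option autoImplicit false

open CategoryTheory NumberField IsDedekindDomain Field ValuativeRel
open Literature.NumberTheory.EllipticCurves Literature.NumberTheory.EllipticCurves.GreenbergSelmer
open Literature.NumberTheory.EllipticCurves.GreenbergVatsal2000
open Literature.NumberTheory.GaloisRepresentations
open Literature.NumberTheory.GaloisRepresentations.DiscreteGaloisModule (SelmerStructure mu MuCarrier TateDual tateDual
  coindTateDualMor coindTateDualHom)
open Literature.NumberTheory.GaloisCohomology
open Summit.BirchSwinnertonDyer.Rank1Residual.X11b.LocBridge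
open Summit.BirchSwinnertonDyer.Rank1Residual.GaloisImage.Transport (tateDualComap tateDualComap_apply_apply)

namespace Summit.BirchSwinnertonDyer.BirchSwinnertonDyer.Theorems.PrintCf2.LayerShapiro

variable {K : Type} [Field K] [NumberField K]
variable {M : Type} [AddCommGroup M] [DistribMulAction (absoluteGaloisGroup K) M] [TopologicalSpace M] [DiscreteTopology M]
  (hM : ∀ m : M, IsOpen {σ : absoluteGaloisGroup K | σ • m = m})
  (U : Subgroup (absoluteGaloisGroup K)) [U.Normal] (hU : IsOpen (U : Set (absoluteGaloisGroup K)))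
  [Fintype (absoluteGaloisGroup K ⧸ U)] {s : absoluteGaloisGroup K ⧸ U → absoluteGaloisGroup K}
  (hs : ∀ y, (s y : absoluteGaloisGroup K ⧸ U) = y) (hs1 : s ((1 : absoluteGaloisGroup K) : absoluteGaloisGroup K ⧸ U) = 1)
  (w : HeightOneSpectrum (𝓞 K))

variable {M' : Type} [AddCommGroup M'] [DistribMulAction (absoluteGaloisGroup K) M'] [TopologicalSpace M'] [DiscreteTopology M']
  (hM' : ∀ m : M', IsOpen {σ : absoluteGaloisGroup K | σ • m = m})
  [Finite M] {n : ℕ} (B : M →+ M' →+ MuCarrier K n)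
  (hB : ∀ (σ : absoluteGaloisGroup K) (m : M) (m' : M'), B (ofSMul M hM σ m) (ofSMul M' hM' σ m') = mu K n σ (B m m'))

/-! ## §3. The canonical dual local conditions: `(⊤)^* = 0` and `(H¹_ur)^* = H¹_ur` off `S` -/

omit [NumberField K] in
/-- **The dual of «no condition» is «locally trivial»** for THE canonical local invariant maps: a class of `H¹(K_v, V^D)` which pairs to
zero with all of `H¹(K_v, V)` is zero (local Tate duality, `LocalInvariants.canonical_isPerfect`: the adjoint `b ↦ ⟨·, b⟩_v` is injective).
[cite: MilneADT2006, Ch. I, Cor. 2.3] [cite: Howard2004HeegnerKolyvagin, Def. 2.1.6 (arXiv:1202.6340 p. 5)] -/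
theorem eq_zero_of_mem_dualLocalCondition_top [NumberField K] [NeZero n] {V : Type} [AddCommGroup V] [TopologicalSpace V]
    [DiscreteTopology V] [Finite V] (ρ : DiscreteGaloisModule K V) (hρ : ∀ m : V, n • m = 0) (v : HeightOneSpectrum (𝓞 K))
    {b : galoisCohomology ((ρ.tateDual n).toLocal (Sum.inr v)) 1}
    (hb : b ∈ (LocalInvariants.canonical K n).dualLocalCondition ρ (Sum.inr v) ⊤) : b = 0 := by
  have hflip := ((LocalInvariants.canonical_isPerfect (K := K) (n := n) v).2 ρ hρ).2
  apply hflip.1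
  rw [map_zero]
  refine AddMonoidHom.ext fun a ↦ ?_
  rw [AddMonoidHom.flip_apply, AddMonoidHom.zero_apply]
  exact hb a (AddSubgroup.mem_top a)

omit [NumberField K] in
/-- **The dual of «unramified» is «unramified» off `S`** for THE canonical family (Milne I Thm. 2.6, the tree's
`unramifiedOrthogonal_of_isPerfect_allLevels` ∘ `canonical_isPerfect`): at a finite `v ∤ n` where the finite `n`-torsion module `V`
is unramified, a class of `H¹(K_v, V^D)` annihilating `H¹_ur(K_v, V)` is unramified. [cite: MilneADT2006, Ch. I, Thm. 2.6] -/
theorem mem_unramifiedSubgroup_of_mem_dualLocalCondition_unramified [NumberField K] [NeZero n] {V : Type} [AddCommGroup V]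
    [TopologicalSpace V] [DiscreteTopology V] [Finite V] (ρ : DiscreteGaloisModule K V) (hρ : ∀ m : V, n • m = 0)
    (v : HeightOneSpectrum (𝓞 K)) (hv : ((n : ℕ) : 𝓞 K) ∉ v.asIdeal) (hur : GaloisRep.IsUnramifiedAt v ρ)
    {b : galoisCohomology ((ρ.tateDual n).toLocal (Sum.inr v)) 1}
    (hb : b ∈ (LocalInvariants.canonical K n).dualLocalCondition ρ (Sum.inr v)
      (DiscreteGaloisModule.unramifiedSubgroup (GaloisRep.toLocal v ρ) 1)) :
    b ∈ DiscreteGaloisModule.unramifiedSubgroup (GaloisRep.toLocal v (ρ.tateDual n)) 1 := by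
  rw [(SchneiderFreeAdditiveX3.PoitouTateReduction.unramifiedOrthogonal_of_isPerfect_allLevels
    (LocalInvariants.canonical K n) LocalInvariants.canonical_isPerfect ρ hρ v hv hur).1] at hb
  exact hb

/-! ## §4. Naturality: the dual pull-back `H¹(ιc^D)` of a dual-Shapiro class is the dual-Shapiro class of the pushed layer class -/

variable {M₀ : Type} [AddCommGroup M₀] [DistribMulAction (absoluteGaloisGroup K) M₀] [TopologicalSpace M₀] [DiscreteTopology M₀]
  [Finite M₀] (hM₀ : ∀ m : M₀, IsOpen {σ : absoluteGaloisGroup K | σ • m = m})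
  {M₀' : Type} [AddCommGroup M₀'] [DistribMulAction (absoluteGaloisGroup K) M₀'] [TopologicalSpace M₀'] [DiscreteTopology M₀']
  (hM₀' : ∀ m : M₀', IsOpen {σ : absoluteGaloisGroup K | σ • m = m})
  (B₀ : M₀ →+ M₀' →+ MuCarrier K n)
  (hB₀ : ∀ (σ : absoluteGaloisGroup K) (m : M₀) (m' : M₀'), B₀ (ofSMul M₀ hM₀ σ m) (ofSMul M₀' hM₀' σ m') = mu K n σ (B₀ m m'))
  (ιc : ((ofSMul M₀ hM₀).coind U hU).toContRepresentation →ⁱL ((ofSMul M hM).coind U hU).toContRepresentation)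
  (j : M₀ →+ M) (hιc : ∀ (φ : absoluteGaloisGroup K ⧸ U → M₀) (y : absoluteGaloisGroup K ⧸ U), ιc φ y = j (φ y))
  (jD : M' →+ M₀') (hjD : ∀ (σ : absoluteGaloisGroup K) (m' : M'), jD (σ • m') = σ • jD m')
  (hBj : ∀ (m₀ : M₀) (m' : M'), B₀ m₀ (jD m') = B (j m₀) m')

omit [NumberField K] [U.Normal] [Fintype (absoluteGaloisGroup K ⧸ U)] in
/-- **The line's coefficient push `resH1Hom (id, jD) : H¹(U, M′) → H¹(U, M₀′)` IS `H¹(jD|_U)` of the Shapiro files** (`cohomologyMap` of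
`subgroupRepMap`; both send `[f]` to `[jD ∘ f]`). [cite: SerreGaloisCohomology1997, I §2.4] -/
theorem resH1Hom_id_eq_cohomologyMap_subgroupRepMap (c : subgroupH1 U M') :
    resH1Hom (ContinuousMonoidHom.id U) jD (fun _ m ↦ hjD _ m) c =
      cohomologyMap (subgroupRepMap
        (TopRep.ofHom ⟨⟨jD.toIntLinearMap, continuous_of_discreteTopology⟩, fun σ ↦ by ext m; exact hjD σ m⟩ :
          (ofSMul M' hM').toTopRep ⟶ (ofSMul M₀' hM₀').toTopRep) U) 1 c := by
  obtain ⟨f, rfl⟩ := oneCocycleClass_surjective (subgroupRep (ofSMul M' hM').toTopRep U) c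
  rw [cohomologyMap_oneCocycleClass]
  have e : resH1Hom (ContinuousMonoidHom.id U) jD (fun _ m ↦ hjD _ m)
        (oneCocycleClass (subgroupRep (ofSMul M' hM').toTopRep U) f) =
      oneCocycleClass _ (contOneCocycles.pullback (ContinuousMonoidHom.id U)
        (resHomOfEquivariant (ContinuousMonoidHom.id U) jD (fun _ m ↦ hjD _ m)) f) :=
    map_oneCocycleClass _ _ _ f
  rw [e]
  exact congrArg _ (Subtype.ext (ContinuousMap.ext fun _ ↦ rfl))

omit [NumberField K] [U.Normal] in
include j hιc hBj in
/-- **NATURALITY OF THE DUAL SHAPIRO LIFT IN THE LEVEL.** For a layer class `y′ ∈ H¹(U, M′)`: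
`H¹(ιc^D) (H¹(Ψ) (Sh y′)) = H¹(Ψ₀) (Sh (jD_* y′))`, where `ιc = Maps(Γ_K ⧸ U, j)`, `ιc^D = tateDualComap ιc`, and `jD : M′ → M₀′` is the
TRANSPOSE of `j : M₀ → M` for the two perfect pairings (`B₀(m₀, jD m′) = B(j m₀, m′)`) — on cocycles both sides are
`σ ↦ (φ ↦ Σ_y B(j(φ y), F(σ)(y)))`. For the levels `A[p^k] ↪ A[p^m]` of a divisible module and `μ`-valued pairings, `jD` is the
`p^{m−k}`-th power map `μ_{p^m} → μ_{p^k}` (reduction of Kummer classes). [cite: MilneADT2006, Ch. I §2]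
[cite: NeukirchSchmidtWingberg2008, I §5 Prop. (1.5.3)(iv), I §6 Prop. (1.6.4)] -/
theorem map_tateDualComap_dualShapiro (y' : subgroupH1 U M') :
    galoisCohomology.map (tateDualComap ιc) 1
        (cohomologyMap (coindTateDualMor (ofSMul M hM) (ofSMul M' hM') U B hU hB) 1
          (shapiroLift (ofSMul M' hM').toTopRep U hU hs hs1 y')) =
      cohomologyMap (coindTateDualMor (ofSMul M₀ hM₀) (ofSMul M₀' hM₀') U B₀ hU hB₀) 1
        (shapiroLift (ofSMul M₀' hM₀').toTopRep U hU hs hs1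
          (resH1Hom (ContinuousMonoidHom.id U) jD (fun _ m ↦ hjD _ m) y')) := by
  rw [resH1Hom_id_eq_cohomologyMap_subgroupRepMap U hM' hM₀' jD hjD, shapiroLift_cohomologyMap]
  obtain ⟨G, hG⟩ := oneCocycleClass_surjective (coindFin (ofSMul M' hM').toTopRep U)
    (shapiroLift (ofSMul M' hM').toTopRep U hU hs hs1 y')
  rw [← hG, cohomologyMap_oneCocycleClass, cohomologyMap_oneCocycleClass, cohomologyMap_oneCocycleClass,
    galoisCohomology.map_one_oneCocycleClass]
  congr 1
  refine Subtype.ext (ContinuousMap.ext fun σ ↦ TateDual.ext fun φ ↦ ?_)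
  change tateDualComap ιc (coindTateDualHom U B (G.1 σ)) φ = coindTateDualHom U B₀ (fun y ↦ jD (G.1 σ y)) φ
  rw [tateDualComap_apply_apply, DiscreteGaloisModule.coindTateDualHom_apply_apply,
    DiscreteGaloisModule.coindTateDualHom_apply_apply]
  exact Finset.sum_congr rfl fun y _ ↦ by rw [hιc, hBj]

/-! ## §5. THE READING: `hkill` of B2c from (PRO-NULL) in the line's currency -/

include hM₀' B₀ hB₀ j hιc hBj in
/-- **`hkill` FROM THE `U`-CURRENCY (PRO-NULL).** Setting of B2c (`exists_layerClass_of_dualPullback_eq_zero`, p702949): `K` a number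
field, `U ⊴ Γ_K` open of finite index, `M₀ →j M` finite discrete `Γ_K`-modules killed by `n`, `ιc = Maps(Γ_K ⧸ U, j)`, `S ⊇` the places
where `n` is not invertible or `Maps(Γ_K ⧸ U, M)` is ramified, `𝓕` a Selmer structure on `Maps(Γ_K ⧸ U, M)` unramified outside `S`. DUAL
DATA: discrete `Γ_K`-modules `M′`, `M₀′` with PERFECT equivariant pairings `B : M × M′ → μₙ`, `B₀ : M₀ × M₀′ → μₙ` and the transpose
`jD : M′ → M₀′` of `j`. THEN the displayed hypothesis `hkill` of B2c — «`H¹(ιc^D)` kills the canonical dual Selmer group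
`H¹_{𝓕*}(K, Maps(Γ_K ⧸ U, M)^D)`» — FOLLOWS from the statement in the line's currency:
«every `y′ ∈ H¹(U, M′)` which is (i) LOCALLY TRIVIAL at every place of `K̄^U` above each `w` with `𝓕_w = ⊤`
(`∀ σ, conjH1 U M′ σ y′ ∈ awayKer U M′ w`), (ii) UNRAMIFIED at every place of `K̄^U` above each finite `w ∤ n` where `𝓕_w` is the
unramified condition and `Maps(Γ_K ⧸ U, M)` is unramified — every `w ∉ S`, and the `w ∈ S` of that kind —
(`∀ σ, conjH1 U M′ σ y′ ∈ unramifiedKer U M′ w`), and (iii) whose dual-Shapiro class satisfies the dual local condition `𝓕*_v` at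
every place `v` (displayed VERBATIM — needed only where (i)/(ii) do not read it: at `v̄ ∣ n` (brick B5: «`n ∣ ord`»), at the places of
`S` where `M` is ramified, at the infinite places), has `jD_* y′ = 0` in `H¹(U, M₀′)`» — which, for `M = ℤ/p^m`, `M′ = μ_{p^m}`, `jD = (·)^{p^{m−k}}`, is the
(PRO-NULL) of the `v`-adic Kummer tower (`KummerU.exists_level_forall_exists_pow_eq_of_galois′`, -w3 g13, ⟸ R1 p696581 = Leopoldt/Brumer).
Proof: every dual class is `H¹(Ψ)(Sh y′)` (`exists_unique_shapiroLift_coindTateDualMor_eq`); §2–§3 read its local conditions; §4 turns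
`H¹(ιc^D)` into `jD_*`. [cite: GreenbergVatsal2000, §2 Prop. 2.1] [cite: MilneADT2006, Ch. I, Cor. 2.3, Thm. 2.6]
[cite: Howard2004HeegnerKolyvagin, Thm. 2.1.11 (arXiv:1202.6340 p. 6)] [cite: NeukirchSchmidtWingberg2008, I §6 Prop. (1.6.4)–(1.6.5)] -/
theorem dualPullback_eq_zero_of_layerProNull [NeZero n] (hMn : ∀ m : M, n • m = 0)
    (hBbij : Function.Bijective fun m' : M' ↦ B.flip m')
    (𝓕 : SelmerStructure ((ofSMul M hM).coind U hU))
    (hPN : ∀ y' : subgroupH1 U M',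
      (∀ w : HeightOneSpectrum (𝓞 K), 𝓕 (Sum.inr w) = ⊤ →
        ∀ σ : absoluteGaloisGroup K, conjH1 U M' σ y' ∈ GreenbergSelmer.awayKer U M' w) →
      (∀ w : HeightOneSpectrum (𝓞 K),
        𝓕 (Sum.inr w) = DiscreteGaloisModule.unramifiedSubgroup (GaloisRep.toLocal w ((ofSMul M hM).coind U hU)) 1 →
        ((n : ℕ) : 𝓞 K) ∉ w.asIdeal → GaloisRep.IsUnramifiedAt w ((ofSMul M hM).coind U hU) →
        ∀ σ : absoluteGaloisGroup K, conjH1 U M' σ y' ∈ GreenbergVatsal2000.unramifiedKer U M' w) →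
      (∀ v : Place K, galoisCohomology.localization (((ofSMul M hM).coind U hU).tateDual n) v 1
          (cohomologyMap (coindTateDualMor (ofSMul M hM) (ofSMul M' hM') U B hU hB) 1
            (shapiroLift (ofSMul M' hM').toTopRep U hU hs hs1 y')) ∈
        (LocalInvariants.canonical K n).dualLocalCondition ((ofSMul M hM).coind U hU) v (𝓕 v)) →
      resH1Hom (ContinuousMonoidHom.id U) jD (fun _ m ↦ hjD _ m) y' = 0) :
    ∀ y ∈ ((LocalInvariants.canonical K n).dualSelmerStructure ((ofSMul M hM).coind U hU) 𝓕).selmerGroup,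
      galoisCohomology.map (tateDualComap ιc) 1 y = 0 := by
  intro y hy
  obtain ⟨y', hy', -⟩ := DiscreteGaloisModule.exists_unique_shapiroLift_coindTateDualMor_eq (ofSMul M hM) (ofSMul M' hM') U B
    hU hB hBbij hs hs1 y
  subst hy'
  have hloc : ∀ v : Place K, galoisCohomology.localization (((ofSMul M hM).coind U hU).tateDual n) v 1
      (cohomologyMap (coindTateDualMor (ofSMul M hM) (ofSMul M' hM') U B hU hB) 1
        (shapiroLift (ofSMul M' hM').toTopRep U hU hs hs1 y')) ∈
      (LocalInvariants.canonical K n).dualLocalCondition ((ofSMul M hM).coind U hU) v (𝓕 v) := fun v ↦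
    (SelmerStructure.mem_selmerGroup_iff _ _).1 hy v
  have hMn' : ∀ φ : absoluteGaloisGroup K ⧸ U → M, n • φ = 0 := fun φ ↦
    funext fun y ↦ by rw [Pi.smul_apply, Pi.zero_apply, hMn]
  have h0 := hPN y'
    (fun w hw σ ↦ conjH1_mem_awayKer_of_localization_dualShapiro_eq_zero hM U hU hs hs1 w hM' B hB hBbij y'
      (eq_zero_of_mem_dualLocalCondition_top _ hMn' w (by
        have h := hloc (Sum.inr w)
        rw [hw] at h
        exact h)) σ)
    (fun w hw hn hur σ ↦ conjH1_mem_unramifiedKer_of_localization_dualShapiro_mem hM U hU hs hs1 w hM' B hB hBbij y'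
      (mem_unramifiedSubgroup_of_mem_dualLocalCondition_unramified _ hMn' w hn hur (by
        have h := hloc (Sum.inr w)
        rw [hw] at h
        exact h)) σ)
    hloc
  rw [map_tateDualComap_dualShapiro hM U hU hs hs1 hM' B hB hM₀ hM₀' B₀ hB₀ ιc j hιc jD hjD hBj, h0]
  have hz : shapiroLift (ofSMul M₀' hM₀').toTopRep U hU hs hs1 (0 : subgroupH1 U M₀') = 0 := map_zero _
  rw [hz]
  exact map_zero _


include hM₀' B₀ hB₀ hιc hBj in
/-- **(SUR_U) AT A FINITE LEVEL FROM (PRO-NULL) IN THE LINE'S CURRENCY** = B2c `exists_layerClass_of_dualPullback_eq_zero` (p702949) with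
its displayed hypothesis `hkill` DISCHARGED by `dualPullback_eq_zero_of_layerProNull`: for `K`, `U`, `M₀ →j M` (`n • M = 0`), `ιc`, `S`,
`𝓕` (unramified at `w ∤ p` and at `v̄`), targets `τ₀` above `T` as in B2c, and dual data `(M′, B)`, `(M₀′, B₀)`, `jD` as in §4–§5:
IF every layer class `y′ ∈ H¹(U, M′)` of the DUAL module which is locally trivial above the `𝓕 = ⊤` places, unramified above the good
places, and satisfies the displayed dual condition elsewhere has `jD_* y′ = 0`, THEN some `z ∈ H¹(U, M)` realises the pushed targets
`j_* τ₀` above `T` modulo classes dying on `U ⊓ I_w` and is unramified above every other `w ∤ p` / `w = v̄` (both clauses of (LS↑)).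
[cite: GreenbergVatsal2000, §2 Prop. 2.1] [cite: MilneADT2006, Ch. I, Thm. 4.10 (b)] [cite: Howard2004HeegnerKolyvagin, Thm. 2.1.11 (arXiv:1202.6340 p. 6)] -/
theorem exists_layerClass_of_layerProNull (p : ℕ) [NeZero n] (hMn : ∀ m : M, n • m = 0)
    (hj : ∀ (σ : absoluteGaloisGroup K) (m : M₀), j (σ • m) = σ • j m)
    (hBbij : Function.Bijective fun m' : M' ↦ B.flip m')
    (vbar : HeightOneSpectrum (𝓞 K)) (S : Finset (Place K))
    (hS : ∀ w : HeightOneSpectrum (𝓞 K), (Sum.inr w : Place K) ∉ S →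
      ((n : ℕ) : 𝓞 K) ∉ w.asIdeal ∧ GaloisRep.IsUnramifiedAt w ((ofSMul M hM).coind U hU))
    (𝓕 : SelmerStructure ((ofSMul M hM).coind U hU)) (h𝓕S : 𝓕.IsUnramifiedOutside S)
    (h𝓕u : ∀ w : HeightOneSpectrum (𝓞 K), (((p : ℕ) : 𝓞 K) ∉ w.asIdeal ∨ w = vbar) →
      𝓕 (Sum.inr w) = DiscreteGaloisModule.unramifiedSubgroup (GaloisRep.toLocal w ((ofSMul M hM).coind U hU)) 1)
    (T : Finset (HeightOneSpectrum (𝓞 K))) (hT : ∀ w ∈ T, ((p : ℕ) : 𝓞 K) ∉ w.asIdeal ∨ w = vbar)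
    (hTS : ∀ w ∈ T, (Sum.inr w : Place K) ∈ S)
    (τ₀ : (w : HeightOneSpectrum (𝓞 K)) →
      DoubleCoset.Quotient (decomp (K := K) w : Set (absoluteGaloisGroup K)) (U : Set (absoluteGaloisGroup K)) →
        subgroupH1 (decompIn U w) M₀)
    (hPN : ∀ y' : subgroupH1 U M',
      (∀ w : HeightOneSpectrum (𝓞 K), 𝓕 (Sum.inr w) = ⊤ →
        ∀ σ : absoluteGaloisGroup K, conjH1 U M' σ y' ∈ GreenbergSelmer.awayKer U M' w) →
      (∀ w : HeightOneSpectrum (𝓞 K),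
        𝓕 (Sum.inr w) = DiscreteGaloisModule.unramifiedSubgroup (GaloisRep.toLocal w ((ofSMul M hM).coind U hU)) 1 →
        ((n : ℕ) : 𝓞 K) ∉ w.asIdeal → GaloisRep.IsUnramifiedAt w ((ofSMul M hM).coind U hU) →
        ∀ σ : absoluteGaloisGroup K, conjH1 U M' σ y' ∈ GreenbergVatsal2000.unramifiedKer U M' w) →
      (∀ v : Place K, galoisCohomology.localization (((ofSMul M hM).coind U hU).tateDual n) v 1
          (cohomologyMap (coindTateDualMor (ofSMul M hM) (ofSMul M' hM') U B hU hB) 1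
            (shapiroLift (ofSMul M' hM').toTopRep U hU hs hs1 y')) ∈
        (LocalInvariants.canonical K n).dualLocalCondition ((ofSMul M hM).coind U hU) v (𝓕 v)) →
      resH1Hom (ContinuousMonoidHom.id U) jD (fun _ m ↦ hjD _ m) y' = 0) :
    ∃ z : subgroupH1 U M,
      (∀ w ∈ T, ∀ q : DoubleCoset.Quotient (decomp (K := K) w : Set (absoluteGaloisGroup K)) (U : Set (absoluteGaloisGroup K)),
        resOfLe M (inertiaIn_le_decompIn U w)
          (resH1Hom (decompInToH U w) (AddMonoidHom.id M) (fun _ _ ↦ rfl) (conjH1 U M q.out z) -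
            resH1Hom (ContinuousMonoidHom.id (decompIn U w)) j (fun _ m ↦ hj _ m) (τ₀ w q)) = 0) ∧
      (∀ w : HeightOneSpectrum (𝓞 K), w ∉ T → (((p : ℕ) : 𝓞 K) ∉ w.asIdeal ∨ w = vbar) →
        ∀ σ : absoluteGaloisGroup K, conjH1 U M σ z ∈ GreenbergVatsal2000.unramifiedKer U M w) :=
  exists_layerClass_of_dualPullback_eq_zero hM₀ hM U hU p n hMn ιc j hj hιc vbar S hS 𝓕 h𝓕S h𝓕u T hT hTS τ₀
    (dualPullback_eq_zero_of_layerProNull hM U hU hs hs1 hM' B hB hM₀ hM₀' B₀ hB₀ ιc j hιc jD hjD hBj hMn hBbij 𝓕 hPN)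

end Summit.BirchSwinnertonDyer.BirchSwinnertonDyer.Theorems.PrintCf2.LayerShapiro

end
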